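import Summits.ResolutionOfSingularities.KangarooAtlas.MizutaniLowerBound
import Summits.ResolutionOfSingularities.KangarooAtlas.MizutaniRootTowerDegree
import HarnessLib

/-!
# The profile bound at a point: `dim θ(f) ≥ 2p − 1` for a genuine invariant form (Mizutani 1973, proof of Thm. 2.8)

Cell `pub-rosobs`, Mizutani enclosure (seat mizutani-encloser-2, gen 6). AI-written; AI review is weaker than expert
review; NOT a resolution-of-singularities theorem (summit relevance C).

Mizutani's proof of Thm. 2.8 (first part, p. 90) runs: for an invariant additive form `f` of exponent one,
`dim_k Diff_{i+1}(k) f ≥ dim_k Diff_i(k) f + 2`, hence `dim_k θ_1(f) = dim_k Diff_{p−1}(k)·f ≥ 2p − 1`, and `θ_1(f)` consists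
of additive forms through the point; so the point imposes at most `#supp(f) − (2p − 1)` independent conditions on the
`p`-th powers of the coordinates occurring in `f`.  The tree proves the profile inequality abstractly (`profile_theorem`,
`σ_{q−1} ≥ 2q − 1`, encloser-1) and uses only its rank corollary THEOREM F.  This file extracts the PROFILE form, at tower level:

* tower level (`IsRootTower L K q x a`, operators `sigD_T`, coordinates `Ω`): `pairTensor`, `IsRootTower.thetaSpan`
  (`Θ_m(v) = span_K {(sigD_T v_i)_i : |T| ≤ m}`), `IsRootTower.Omega_injective`, **`IsRootTower.two_mul_pow_le_finrank_thetaSpan_succ`**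
  (`2q ≤ dim_K Θ_{q−1}(v) + 1` when `Σ v_i ⊗ w_i ∈ J^q ∖ I_S`), `IsRootTower.sum_sigD_mul_eq_zero` / `thetaSpan_le_ker`
  (`Θ_{q−1}(v)` is killed by every column `w'` with `Σ v_i ⊗ w'_i ∈ J^q`), `thetaSpan_apply_eq_zero` (supports);
* **`IsRootTower.two_mul_pow_add_finrank_span_rows_le`** — rank form: if moreover `Σ_i v_i ⊗ W_j i ∈ J^q` for a family of columns
  `W_j`, the rows `(W_j i)_j`, `i ∈ supp v`, span at most `#supp(v) + 1 − 2q` dimensions (`2q + dim span ≤ #supp(v) + 1`).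

The point-level consequences (`𝔭` a point of `ℙ^n_k`, `f ∈ (L_B)_1 ∖ 0`: the `ξ_i^p`, `i ∈ supp f`, span at most `#supp(f) + 1 − 2p`
dimensions; `#supp(f) ≥ 2p`) are drawn in `MizutaniExtremalProfilePoint.lean`; they feed `MizutaniExtremal.lean` (structure of the
extremal schemes at `e = 1`, Thm. 2.8 second part).

## References

* H. Mizutani, *Hironaka's additive group schemes*, Nagoya Math. J. 52 (1973) 85–95, proof of Thm. 2.8 (p. 90–91).
  [Mizutani1973HironakaGroupSchemes]
* T. Oda, *Hironaka's additive group scheme, II*, Publ. RIMS 19 (1983), §1 (p. 1166), Cor. 2.3. [Oda1983HironakaGroupSchemeII]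
-/

noncomputable section

open MvPolynomial TensorProduct Literature.AlgebraicGeometry.Resolution
  Literature.AlgebraicGeometry.Resolution.HironakaScheme

namespace Summit.ResolutionOfSingularities.KangarooAtlas.Mizutani

universe u

/-! ## Tower level: the span `Θ_m(v)` and its dimension -/

section TowerProfile

variable {L K : Type*} [Field L] [Field K] [Algebra L K] {s p e : ℕ} [hp : Fact p.Prime] [CharP K p]
  {x : Fin s → L} {a : Fin s → K} {ι : Type*} [Fintype ι]

variable (L) in
/-- `Λ_w : K^ι → K ⊗_L K`, `g ↦ Σ_i g_i ⊗ w_i` (left `K`-structure). [folklore] -/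
noncomputable def pairTensor (w : ι → K) : (ι → K) →ₗ[K] K ⊗[L] K where
  toFun g := ∑ i, g i ⊗ₜ[L] w i
  map_add' g g' := by
    rw [← Finset.sum_add_distrib]
    exact Finset.sum_congr rfl fun i _ => by rw [Pi.add_apply, TensorProduct.add_tmul]
  map_smul' c g := by
    rw [RingHom.id_apply, Finset.smul_sum]
    exact Finset.sum_congr rfl fun i _ => by rw [Pi.smul_apply, TensorProduct.smul_tmul']

omit [Fact p.Prime] [CharP K p] in
/-- `Λ_w g` unfolded. [folklore] -/
theorem pairTensor_apply (w g : ι → K) : pairTensor L w g = ∑ i, g i ⊗ₜ[L] w i := rfl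

omit [Fact p.Prime] [CharP K p] in
/-- `(D ⊗ 1)(Λ_w g) = Λ_w (D ∘ g)` for an `L`-linear `D`. [folklore] -/
theorem map_pairTensor (D : K →ₗ[L] K) (w g : ι → K) :
    TensorProduct.map D LinearMap.id (pairTensor L w g) = pairTensor L w (fun i => D (g i)) := by
  rw [pairTensor_apply, pairTensor_apply, map_sum]
  exact Finset.sum_congr rfl fun i _ => by rw [TensorProduct.map_tmul, LinearMap.id_apply]

omit [Fact p.Prime] [CharP K p] in
/-- `μ(Λ_w g) = Σ_i g_i w_i`. [folklore] -/
theorem lmul''_pairTensor (w g : ι → K) :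
    Algebra.TensorProduct.lmul'' L (S := K) (pairTensor L w g) = ∑ i, g i * w i := by
  rw [pairTensor_apply, map_sum]
  rfl

/-- **`Θ_m(v) = span_K {(sigD_T v_i)_i : |T| ≤ m} ⊆ K^ι`** — Mizutani's `Diff_m(k)·f` for the coefficient vector `v` of an additive form,
with the tower's (anti-)Hasse–Schmidt operators in place of `Diff_m`. [cite: Mizutani1973HironakaGroupSchemes, proof of Thm. 2.8 (Diff_i(k) f)] -/
noncomputable def IsRootTower.thetaSpan (h : IsRootTower L K (p ^ e) x a) (m : ℕ) (v : ι → K) :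
    Submodule K (ι → K) :=
  Submodule.span K ((fun T : Fin s →₀ ℕ => fun i => h.sigD T (v i)) '' (degLE (Fin s) m : Set (Fin s →₀ ℕ)))

omit [Fintype ι] in
/-- `Θ_m(v)` is finite-dimensional. [folklore] -/
theorem IsRootTower.thetaSpan_finite (h : IsRootTower L K (p ^ e) x a) (m : ℕ) (v : ι → K) :
    Module.Finite K (h.thetaSpan m v) := by
  unfold IsRootTower.thetaSpan
  exact Module.Finite.span_of_finite K ((Finset.finite_toSet _).image _)

/-- `Ω` is injective (`Ω̃` is bijective and the box representative is faithful). [cite: Oda1983HironakaGroupSchemeII, §1 (p. 1166: R ≅ k[t]/(t^q))] -/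
theorem IsRootTower.Omega_injective (h : IsRootTower L K (p ^ e) x a) : Function.Injective h.Omega := by
  intro ω₁ ω₂ hΩ
  rw [h.Omega_eq, h.Omega_eq] at hΩ
  have h1 : h.omegaTilde ω₁ = h.omegaTilde ω₂ := by
    rw [← mk_truncQ (h.omegaTilde ω₁), ← mk_truncQ (h.omegaTilde ω₂), hΩ]
  exact h.omegaTilde_bijective'.1 h1

/-- `Λ_w(Θ_m(v)) = span_K {(sigD_T ⊗ 1) ω : |T| ≤ m}`, `ω = Λ_w v`. [folklore] -/
theorem IsRootTower.map_pairTensor_thetaSpan (h : IsRootTower L K (p ^ e) x a) (m : ℕ) (v w : ι → K) :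
    (h.thetaSpan m v).map (pairTensor L w) =
      Submodule.span K ((fun T : Fin s →₀ ℕ => TensorProduct.map (h.sigD T) LinearMap.id (pairTensor L w v)) ''
        (degLE (Fin s) m : Set (Fin s →₀ ℕ))) := by
  unfold IsRootTower.thetaSpan
  rw [Submodule.map_span, Set.image_image]
  congr 1
  refine Set.image_congr fun T _ => ?_
  rw [map_pairTensor]

/-- `Ω(span_K {(sigD_T ⊗ 1) ω : |T| ≤ m}) = eSpan_m(Ω ω)` for `m + 1 ≤ q`. [folklore] -/
theorem IsRootTower.map_Omega_span (h : IsRootTower L K (p ^ e) x a) {m : ℕ} (hm : m + 1 ≤ p ^ e) (ω : K ⊗[L] K) :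
    (Submodule.span K ((fun T : Fin s →₀ ℕ => TensorProduct.map (h.sigD T) LinearMap.id ω) ''
        (degLE (Fin s) m : Set (Fin s →₀ ℕ)))).map h.Omega =
      eSpan (fun T => (h.sigD T).toAddMonoidHom) m (h.Omega ω) := by
  unfold eSpan
  rw [Submodule.map_span, Set.image_image]
  congr 1
  refine Set.image_congr fun T hT => ?_
  have hT' : T.degree ≤ m := mem_degLE.mp (Finset.mem_coe.mp hT)
  exact h.Omega_map T ω (by omega)

/-- **THE PROFILE BOUND in a tower**: if `ω = Σ_i v_i ⊗ w_i ∈ J^q ∖ I_S` (genuine), then `2q ≤ dim_K Θ_{q−1}(v) + 1` — the images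
`(sigD_T ⊗ 1) ω`, `|T| ≤ q − 1`, of `Θ_{q−1}(v)` under `Λ_w` have coordinates spanning `eSpan_{q−1}(Ω ω)`, of dimension
`σ_{q−1} ≥ 2q − 1` (`profile_theorem`). [cite: Mizutani1973HironakaGroupSchemes, proof of Thm. 2.8 ("dim_k Diff_{i+1}(k) f ≥ dim_k Diff_i(k) f + 2")] -/
theorem IsRootTower.two_mul_pow_le_finrank_thetaSpan_succ (h : IsRootTower L K (p ^ e) x a) (v w : ι → K)
    (hJ : pairTensor L w v ∈ KaehlerDifferential.ideal L K ^ p ^ e)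
    (hI : pairTensor L w v ∉ frobPowerIdeal L p ^ p ^ (e - 1)) :
    2 * p ^ e ≤ Module.finrank K (h.thetaSpan (p ^ e - 1) v) + 1 := by
  set ω := pairTensor L w v with hω
  obtain ⟨M, hM, hgen⟩ := h.exists_isGenuine_of_not_mem' hJ hI
  obtain ⟨hs, he⟩ := two_le_of_isGenuine hgen
  haveI : Infinite L := h.infinite (by omega) he
  haveI := h.finiteDimensional
  have hq : 1 ≤ p ^ e := Nat.one_le_pow _ _ hp.out.pos
  have hdeg := h.degree_le_of_mem_pow hJ
  -- the profile theorem for the operators `sigD_T` and the polynomial `Ω ω`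
  have hgood : GoodOps (algebraMap L K).range (fun T => (h.sigD T).toAddMonoidHom) := by
    refine ⟨?_, ?_⟩
    · ext y
      simp [h.sigD_zero]
    · rintro c ⟨l, rfl⟩ T y
      show h.sigD T (algebraMap L K l * y) = algebraMap L K l * h.sigD T y
      rw [← Algebra.smul_def, ← Algebra.smul_def, LinearMap.map_smul]
  have hinf : ((algebraMap L K).range : Set K).Infinite := by
    have : ((algebraMap L K).range : Set K) = Set.range (algebraMap L K) := rfl
    rw [this]
    exact Set.infinite_range_of_injective (algebraMap L K).injective
  have hadm : ∀ M ∈ (h.Omega ω).support, InBox (p ^ e) M ∧ p ^ e ≤ M.degree :=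
    fun M hM => ⟨h.Omega_box ω M hM, hdeg M hM⟩
  have h1 := profile_theorem (p := p) (e := e) (algebraMap L K).range hinf he s hs
    (fun T => (h.sigD T).toAddMonoidHom) (h.Omega ω) hgood hadm ⟨M, hM, hgen⟩ (p ^ e - 1) (by omega)
  -- `eProfile = finrank (Λ_w Θ)` (Ω injective) `≤ finrank Θ`
  haveI := h.thetaSpan_finite (p ^ e - 1) v
  have h2 : Module.finrank K ((h.thetaSpan (p ^ e - 1) v).map (pairTensor L w)) ≤
      Module.finrank K (h.thetaSpan (p ^ e - 1) v) := Submodule.finrank_map_le _ _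
  have h3 : Module.finrank K (((h.thetaSpan (p ^ e - 1) v).map (pairTensor L w)).map h.Omega) =
      Module.finrank K ((h.thetaSpan (p ^ e - 1) v).map (pairTensor L w)) :=
    (Submodule.equivMapOfInjective h.Omega h.Omega_injective _).finrank_eq.symm
  have h4 : ((h.thetaSpan (p ^ e - 1) v).map (pairTensor L w)).map h.Omega =
      eSpan (fun T => (h.sigD T).toAddMonoidHom) (p ^ e - 1) (h.Omega ω) := by
    rw [h.map_pairTensor_thetaSpan, h.map_Omega_span (by omega)]
  rw [h4] at h3
  unfold eProfile at h1
  omega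

/-- **`Θ` is killed by every column through `J^q`**: if `Σ_i v_i ⊗ w'_i ∈ J^q` then `Σ_i sigD_T(v_i) w'_i = 0` for `|T| ≤ q − 1`
(`μ ∘ (sigD_T ⊗ 1)` vanishes on `J^q`: the constant coefficient of `E_T(Ω ω')` is zero when all monomials of `Ω ω'` have degree
`≥ q > |T|`). [cite: Oda1983HironakaGroupSchemeII, §1 (p. 1166: Δ^{(r)} and the operators of order < r)] -/
theorem IsRootTower.sum_sigD_mul_eq_zero (h : IsRootTower L K (p ^ e) x a) (v w' : ι → K)
    (hJ : pairTensor L w' v ∈ KaehlerDifferential.ideal L K ^ p ^ e) {T : Fin s →₀ ℕ} (hT : T.degree + 1 ≤ p ^ e) :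
    ∑ i, h.sigD T (v i) * w' i = 0 := by
  have hdeg := h.degree_le_of_mem_pow hJ
  rw [← lmul''_pairTensor (L := L), ← map_pairTensor, ← h.Omega_coeff_zero, h.Omega_map T _ hT]
  exact coeff_zero_opE_eq_zero _ T _ fun M hM => by have := hdeg M hM; omega

/-- Hence every `g ∈ Θ_m(v)` (`m + 1 ≤ q`) satisfies `Σ_i g_i w'_i = 0` for every such column `w'`. [folklore] -/
theorem IsRootTower.thetaSpan_sum_mul_eq_zero (h : IsRootTower L K (p ^ e) x a) {m : ℕ} (hm : m + 1 ≤ p ^ e) (v w' : ι → K)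
    (hJ : pairTensor L w' v ∈ KaehlerDifferential.ideal L K ^ p ^ e) {g : ι → K} (hg : g ∈ h.thetaSpan m v) :
    ∑ i, g i * w' i = 0 := by
  -- the functional `g ↦ Σ g_i w'_i` vanishes on the generators of `Θ`
  set φ : (ι → K) →ₗ[K] K := Fintype.linearCombination K w' with hφ
  have hφapply : ∀ g : ι → K, φ g = ∑ i, g i * w' i := fun g => by
    rw [hφ, Fintype.linearCombination_apply]
    exact Finset.sum_congr rfl fun i _ => smul_eq_mul _ _
  have hle : h.thetaSpan m v ≤ LinearMap.ker φ := by
    unfold IsRootTower.thetaSpan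
    rw [Submodule.span_le]
    rintro _ ⟨T, hT, rfl⟩
    rw [SetLike.mem_coe, LinearMap.mem_ker, hφapply]
    have hT' : T.degree ≤ m := mem_degLE.mp (Finset.mem_coe.mp hT)
    exact h.sum_sigD_mul_eq_zero v w' hJ (by omega)
  have := hle hg
  rwa [LinearMap.mem_ker, hφapply] at this

omit [Fintype ι] in
/-- `Θ_m(v)` is supported on the support of `v`: `v_i = 0 ⇒ g_i = 0` for `g ∈ Θ_m(v)`. [folklore] -/
theorem IsRootTower.thetaSpan_apply_eq_zero (h : IsRootTower L K (p ^ e) x a) (m : ℕ) (v : ι → K) {g : ι → K}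
    (hg : g ∈ h.thetaSpan m v) {i : ι} (hi : v i = 0) : g i = 0 := by
  have hle : h.thetaSpan m v ≤ LinearMap.ker (LinearMap.proj i : (ι → K) →ₗ[K] K) := by
    unfold IsRootTower.thetaSpan
    rw [Submodule.span_le]
    rintro _ ⟨T, -, rfl⟩
    rw [SetLike.mem_coe, LinearMap.mem_ker, LinearMap.proj_apply]
    show h.sigD T (v i) = 0
    rw [hi, map_zero]
  have := hle hg
  rwa [LinearMap.mem_ker, LinearMap.proj_apply] at this

/-- **Rank form of the profile bound in a tower.**  Let `ω = Σ_i v_i ⊗ w_i ∈ J^q ∖ I_S` and let `W_j` (`j ∈ κ`) be further columns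
with `Σ_i v_i ⊗ W_j i ∈ J^q` for all `j`.  Then the rows `(W_j i)_j`, `i ∈ supp v`, span a `K`-subspace of dimension
`≤ #supp(v) + 1 − 2q`: `2q + dim_K span_K {row_i : v_i ≠ 0} ≤ #supp(v) + 1`. [cite: Mizutani1973HironakaGroupSchemes, proof of Thm. 2.8 (θ_1(f) ⊂ forms through the point, dim θ_1(f) ≥ 2p − 1)] -/
theorem IsRootTower.two_mul_pow_add_finrank_span_rows_le (h : IsRootTower L K (p ^ e) x a) (v w : ι → K)
    (hJ : pairTensor L w v ∈ KaehlerDifferential.ideal L K ^ p ^ e)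
    (hI : pairTensor L w v ∉ frobPowerIdeal L p ^ p ^ (e - 1))
    {κ : Type*} [Fintype κ] (W : κ → ι → K)
    (hW : ∀ j, pairTensor L (W j) v ∈ KaehlerDifferential.ideal L K ^ p ^ e) :
    2 * p ^ e + Module.finrank K (Submodule.span K
        ((fun i : ι => fun j : κ => W j i) '' (fsupp v : Set ι))) ≤ (fsupp v).card + 1 := by
  classical
  set S : Finset ι := fsupp v with hS
  have hmemS : ∀ i, i ∈ S ↔ v i ≠ 0 := fun i => by rw [hS, mem_fsupp]
  have hq : 1 ≤ p ^ e := Nat.one_le_pow _ _ hp.out.pos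
  have hΘ := h.two_mul_pow_le_finrank_thetaSpan_succ v w hJ hI
  set Θ := h.thetaSpan (p ^ e - 1) v with hΘdef
  haveI := h.thetaSpan_finite (p ^ e - 1) v
  -- the row map on the coordinates in `S`: `f : (S → K) → (κ → K)`, `g ↦ (Σ_{i ∈ S} g_i W_j i)_j`
  let f : (S → K) →ₗ[K] (κ → K) :=
    { toFun := fun g j => ∑ i : S, g i * W j i
      map_add' := fun g g' => by
        funext j
        simp only [Pi.add_apply, add_mul, Finset.sum_add_distrib]
      map_smul' := fun c g => by
        funext j
        simp only [Pi.smul_apply, smul_eq_mul, RingHom.id_apply, Finset.mul_sum, mul_assoc] }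
  have hf_apply : ∀ (g : S → K) (j : κ), f g j = ∑ i : S, g i * W j i := fun g j => rfl
  -- the restriction `res : K^ι → K^S`
  let res : (ι → K) →ₗ[K] (S → K) := LinearMap.funLeft K K ((↑) : S → ι)
  have hres_apply : ∀ (g : ι → K) (i : S), res g i = g i := fun g i => rfl
  -- (1) `res` is injective on `Θ` (`Θ` is supported in `S`)
  have hres_inj : Function.Injective (res.domRestrict Θ) := by
    intro g g' hgg'
    apply Subtype.ext
    funext i
    by_cases hi : v i = 0
    · rw [h.thetaSpan_apply_eq_zero _ v g.2 hi, h.thetaSpan_apply_eq_zero _ v g'.2 hi]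
    · have := congrFun hgg' ⟨i, (hmemS i).mpr hi⟩
      simpa [LinearMap.domRestrict_apply, hres_apply] using this
  -- (2) `res(Θ) ≤ ker f`
  have hres_ker : Θ.map res ≤ LinearMap.ker f := by
    rintro _ ⟨g, hg, rfl⟩
    rw [SetLike.mem_coe] at hg
    rw [LinearMap.mem_ker]
    funext j
    rw [hf_apply, Pi.zero_apply]
    have h1 : ∑ i : S, res g i * W j i = ∑ i ∈ S, g i * W j i := by
      simp only [hres_apply]
      exact Finset.sum_coe_sort S (fun i => g i * W j i)
    have h2 : ∑ i ∈ S, g i * W j i = ∑ i, g i * W j i := by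
      refine Finset.sum_subset (Finset.subset_univ S) fun i _ hi => ?_
      rw [h.thetaSpan_apply_eq_zero _ v hg (by rwa [hmemS, not_not] at hi), zero_mul]
    rw [h1, h2]
    exact h.thetaSpan_sum_mul_eq_zero (by omega) v (W j) (hW j) hg
  -- (3) the rows lie in `range f`
  have hrows : Submodule.span K ((fun i : ι => fun j : κ => W j i) '' (S : Set ι)) ≤ LinearMap.range f := by
    rw [Submodule.span_le]
    rintro _ ⟨i, hi, rfl⟩
    have hi' : i ∈ S := Finset.mem_coe.mp hi
    refine ⟨Pi.single (⟨i, hi'⟩ : S) 1, ?_⟩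
    funext j
    rw [hf_apply, Fintype.sum_eq_single (⟨i, hi'⟩ : S) (fun i' hi'' => by
      rw [Pi.single_eq_of_ne hi'', zero_mul]), Pi.single_eq_same, one_mul]
  -- (4) dimension count: rank–nullity for `f` on `K^S`
  have hrn := LinearMap.finrank_range_add_finrank_ker f
  rw [Module.finrank_fintype_fun_eq_card, Fintype.card_coe] at hrn
  have hker : Module.finrank K Θ ≤ Module.finrank K (LinearMap.ker f) := by
    have e1 : Module.finrank K Θ = Module.finrank K (LinearMap.range (res.domRestrict Θ)) :=
      (LinearEquiv.ofInjective _ hres_inj).finrank_eq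
    rw [e1, LinearMap.range_domRestrict]
    exact Submodule.finrank_mono hres_ker
  have hrange : Module.finrank K (Submodule.span K ((fun i : ι => fun j : κ => W j i) '' (S : Set ι))) ≤
      Module.finrank K (LinearMap.range f) := Submodule.finrank_mono hrows
  omega

end TowerProfile

end Summit.ResolutionOfSingularities.KangarooAtlas.Mizutani

end
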